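import Summits.QuantumFields.YangMills.Theorems.BalabanUVNodesN22AtRecordOfKernelFadingStripSchemas
import Summits.QuantumFields.YangMills.Theorems.BalabanUVNodesN22W1StripGenerator

/-!
# BalabanUVNodes ∕ node N22 = NE9 — «J42 AT THE GENERATED RUN TOWERS»: K3's `h9` WITH THE RECORD's GEOMETRIC MODULI when W1-20's law is met by the run towers
# `truncRun K (toClusterTower (Gn K))` GENERATED by one-step generator towers `Gn K : W1.GenTower` — node N10's per-torus hypothesis `h226TOnOlder` of module J42 (a statement about
# the ACTIVITIES of an ABSTRACT tower, which are free data there) REPLACED by two schemas ON THE GENERATOR ITSELF: (S-loc) locality of the step activity in the older terms on the space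
# tables, (S-226) [II] (2.14)–(2.26) per term along holomorphic curves of complexified older terms — the object def-T ∕ NODE A instantiate and the property node N10's T-row complexified is

Cell `pub-ymgap`, HUMAN RULING D-0062 (Track A), R134 seat `pub-ymgap-dag-n22-c` (strategy s1), generation 15, module J44.  THEOREMS ONLY (no `def`, no `sorry`, standard axioms);
`--kind proof --supports stmt-QuantumFields-27366 --as helper` (K3⁸ `SpineGivenEndpointR13SepCoPHV`, skeleton v6 b4e55110ab73e679 — its §2b N22 face `h9` is K3⁷ v5's verbatim), COUNT-NEUTRAL.
Imports module J42 `…Theorems.BalabanUVNodesN22AtRecordOfKernelFadingStripSchemas` (`ne9_EA_objectsOfRecord₁₃_of_kernelStepRate_stripSchemas` and its pin face) and module 16′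
`…Theorems.BalabanUVNodesN22W1StripGenerator` (g5: `termwise226OnOlder_toClusterTower_of_stepSchemas`; through it module 15′ `…N22W1StripRunTowers`'s `termwise226OnOlder_truncRun` and
node00-def-W1's `Node00.HistoryRecursionOfRecord`: `GenTower`, `StepGen.H`, `OlderTerms`, `toClusterTower`, `truncRun`, `recTerm`).  Nothing re-declared; every step is plain application.

THE POINT (LOCATED, g15 lane audit `README-N22C-LANE-MAP.md` §4).  Module J42's `h226TOnOlder K` quantifies over towers `S K : ClusterTower (F.P K) 𝔸 M` whose step activities `(S K k).H`
are DATA: for an abstract tower the hypothesis relates `H` at level `k` to the terms `termC (S K) j`, `j ≤ k`, which nothing ties together — it is MEETABLE only at towers whose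
activities ARE generated from the older terms, i.e. at def-W1's generated towers `toClusterTower Gn` ([I] p. 256 «E_k depends also on g₀, …, g_{k−1}» — through the older terms ONLY,
(2.12)–(2.13) p. 268; W1 `HistoryRecursionOfRecord` §Recursion).  On a run of length `K` the tower is `truncRun K (toClusterTower (Gn K))` (= `runTowers (fun K => toClusterTower (Gn K)) K`,
`rfl`).  THIS FILE re-keys J42 there: the N10 input becomes the pair of GENERATOR schemas of module 16′ §1 — (S-loc) `hlocG` and (S-226) `h226G` — per torus and step `k′ < K`, and
`h226TOnOlder K` for ALL levels follows (levels `≥ K` are termless: module 15′ `termwise226OnOlder_truncRun`, socket sign `0 ≤ c.α₆·c.ε₂`).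
* §1 ★ `h226TOnOlder_truncRun_toClusterTower_of_genStepSchemas` — generic torus `K`, any letters `(γ, r, A, κ)`: (S-loc) + (S-226) for `Gn` at the steps `k′ < K` ⟹ module J42's
  `h226TOnOlder` body for `truncRun K (toClusterTower Gn)` at EVERY level (one application of 15′ after 16′ §1).
* §2 ★★★ `ne9_EA_objectsOfRecord₁₃_of_kernelStepRate_genStepSchemas` — AT THE RECORD: module J42's theorem with `S := fun K => truncRun K (toClusterTower (Gn K))` and its N10 binder
  produced by §1: node N18's `KernelStepRateOfRecord₁₃ F N θ κ₅ ℓ.θ₅ C₅`; W1-20's law `Localizes17OfRecord₁₃ F N θ (fun K => truncRun K (toClusterTower (Gn K))) emb`; per torus the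
  GENERATOR schemas (S-loc) ∕ (S-226) with the letters `(θ.γ, r_E, E₀, κ)`; node N09's `EHoloAt (sfTowerOfRecord (Sg K) (Rz K) M (truncRun K (toClusterTower (Gn K))) ⟨g, β K⟩ (logZ K)) cs k`
  families (`E₀`, `r_E`); Lemma 3's socket numerals; S25's clauses; term holomorphy through the complexified readings of record; chart ∕ space clauses; site-weight tails; `δ₀ > 0`,
  `2κ₀(64,8) ≤ κ_w ≤ κ`; (1.21) `PolLimitsExistOfRecord₁₃ F N θ`; the letter rows of J42 (jointly satisfiable with `ℓ.Signs`: J42 §2 `exists_letterBlock_rows`) ⟹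
  **`NE9 ((objectsOfRecord₁₃ F N θ ℓ).EA 0) (Window θ.γ) ℓ.κ ℓ.moduli`** (K3's `h9`, the record's GEOMETRIC moduli).
* §3 ★★★ `n22At_rateCarriers_of_kernels_pin_of_kernelStepRate_genStepSchemas` — the N22 pin face `N22At (rateCarriersOfRecord₁₃CoPH 𝔯 F θ hP g₀ os k).u3`, every `k`, under `hpin`.
THE N22 ROW SENTENCE, generator currency: «N18's kernel step rate + def-T's one-step GENERATOR read at complexified older terms ((S-loc), (S-226) = [II] (2.14)–(2.26) per term, node
N10's T-row complexified — NOT printed) + N09's `EHoloAt` families + term holomorphy through the readings + p. 282 tails + W1-20's law AT THE GENERATED RUN TOWERS + (1.21) + numerals +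
letter rows ⇒ K3's `h9` ∕ `N22At` WITH THE RECORD's GEOMETRIC MODULI» — every analytic binder now bears on a CONSTRUCTIBLE object (the generator, the readings, the kernels of record).

HONEST FRAMING (binding).  Count-neutral COMPOSITION of landed theorems by name; NO estimate of Bałaban's is proved or asserted; every displayed input is a HYPOTHESIS with its owner
(N18's kernel step rate: node N18, NE5 NOT PRINTED for d = 4; the generator schemas (S-loc) ∕ (S-226): def-T ∕ NODE A for the object `Gn`, node N10 for the estimate — [II] Lemma 1–3 read
at COMPLEXIFIED older terms along holomorphic curves is the cell's complexification «(or analytic)», NOT a printed display; `EHoloAt` families: N09 — [I] p. 263 «C^∞ … (or analytic)» with a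
uniform margin; readings ∕ tails: NODE A ∕ N09; W1-20's law AT THE GENERATED RUN TOWERS: NODE A ∕ def-W1 — no generator of record is named in the tree today; (1.21): dag-n22-w3's road);
nothing of the record is constructed or claimed to meet them; N22 is NOT discharged (typed 28∕28 · discharged 5∕27 UNCHANGED); K3⁸ OPEN and NOT claimed (no stub of 27366 is touched);
NE9 is NOT IN PRINT for d = 4; no count claim; one finite 𝕋⁴ programme at fixed ε — R4 closes the CONDITIONAL rung `BalabanLadder.UV` only; NOTHING about the continuum limit, ℝ⁴,
infinite volume, OS axioms, a mass gap or the Clay problem is proved or claimed.  References (TYPES only, no cite tags on the Summit side): [I] = Bałaban, CMP 109 (1987) §0 p. 256 with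
(0.22)–(0.23), Thm 1 p. 259, (1.7) p. 261, §1 p. 263 with (1.18), (1.20)–(1.22) p. 264, §2 p. 266, (2.12)–(2.13) p. 268, p. 282 (site-weight tails: the sentence after (4.4)), (4.35)–(4.37)
pp. 290–291, (5.10) p. 293, §5 p. 298; [II] = CMP 116 (1988) (1.41) p. 11, (2.9)–(2.11) p. 14, (2.13)–(2.26) pp. 14–17, Lemma 3 (2.38) p. 20, (2.39)–(2.41) p. 21.
-/

noncomputable section

open Filter Topology Set Metric
open scoped BigOperators

namespace YMDAG.N22.KernelFading

open Literature.MathematicalPhysics.QuantumFieldTheory.Balaban1983to89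
open Literature.MathematicalPhysics.QuantumFieldTheory.Balaban1983to89.T4Continuum (T4Family ULoop)
open Literature.MathematicalPhysics.QuantumFieldTheory.Balaban1983to89.T4OutputRate (Window NE9)
open Literature.MathematicalPhysics.QuantumFieldTheory.Balaban1983to89.TreeLengthTorus (TPt TDom torusTreeLen)
open Literature.MathematicalPhysics.QuantumFieldTheory.Balaban1983to89.B12TreeDecay (K₀ kappa₀ K₀_pos)
open Literature.MathematicalPhysics.QuantumFieldTheory.Balaban1983to89.B12Decay510 (delta1)
open Literature.MathematicalPhysics.QuantumFieldTheory.Balaban1983to89.B12Decay510Window (K₁)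
open Literature.MathematicalPhysics.QuantumFieldTheory.Balaban1983to89.B12Decay510Torus (distCT nearT)
open Literature.MathematicalPhysics.QuantumFieldTheory.Balaban1983to89.B13Lemma3TorusData (TBond)
open Literature.MathematicalPhysics.QuantumFieldTheory.Balaban1983to89.B13Lemma3TorusTerms (terms weight)
open Literature.MathematicalPhysics.QuantumFieldTheory.Balaban1983to89.B13Lemma3TorusSocket (Lemma3Numerics)
open Literature.MathematicalPhysics.QuantumFieldTheory.Balaban1983to89.B12BetaHolo (EHoloAt)
open Literature.MathematicalPhysics.QuantumFieldTheory.Balaban1983to89.Step (SFConsts)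
open Literature.MathematicalPhysics.QuantumFieldTheory.Balaban1983to89.Node00
open Literature.MathematicalPhysics.QuantumFieldTheory.Balaban1983to89.Node00.Sect2 (domSys domCount CPair spaceI domSites Setting Residual)
open Literature.MathematicalPhysics.QuantumFieldTheory.Balaban1983to89.Node00.W1
open Literature.MathematicalPhysics.QuantumFieldTheory.Balaban1983to89.Node00.LocalizedSum17 (localizedSum ReadingMaps Localizes17OfRecord₁₃)
open Literature.MathematicalPhysics.QuantumFieldTheory.Balaban1983to89.Node00.U3OfKernels (histPrefix objectsOfRecord₁₃)
open Literature.MathematicalPhysics.QuantumFieldTheory.Balaban1983to89.Node00.U3KernelLetters (KernelStepRateOfRecord₁₃ PolLimitsExistOfRecord₁₃)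
open YMDAG.UVSplit (N22At RateReading₁₃CoPH rateCarriersOfRecord₁₃CoPH)
open YMDAG.N22.AtKernels (n22At_rateCarriers_of_kernels_pin_of_ne9)
open YMDAG.N22.W1 (termwise226OnOlder_toClusterTower_of_stepSchemas termwise226OnOlder_truncRun)

open scoped Matrix.Norms.L2Operator

variable (F : T4Family)

/-! ## §1 Generic torus: module J42's per-torus `h226TOnOlder` for the run tower GENERATED by `Gn`, from the two generator schemas -/

open Classical in
/-- ★ **NODE N10's OLDER-COUPLING LEVEL-T HYPOTHESIS AT A GENERATED RUN TOWER FROM THE GENERATOR SCHEMAS, EVERY LEVEL.**  Torus `K`, settings `(Sg, Rz)`, a one-step generator tower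
`Gn : GenTower (F.P K) 𝔸 M` (W1 `StepGen`: indices + the generic term (2.14) as a function of the complex last coupling, the OLDER TERMS and the configuration); letters `(γ, r, A, κ)`,
Lemma 3's constants `c` with `0 ≤ c.α₆·c.ε₂`, term data `(L, a, a₅)`.  IF at every step `k′ < K` (S-loc) the step activity `(Gn k′).H t old φ Z` reads the older terms on the space tables
`U^c_j(Y, cs.α₀, cs.α₁)` only, and (S-226) along every older-terms curve `cv : ℂ → OlderTerms` holomorphic on an open `D ⊇` the closed `r`-discs about `]0, γ]` with `‖cv z j Y ψ‖ ≤ A·e^{−κ d_j(Y)}`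
on the spaces, at every real last coupling `s ∈ ]0, γ]`, the complexified activities `z ↦ (Gn k′).H ↑s (cv z) φ Z` (`Z ⊆ X`, `φ ∈ U^c_{k′+1}(X)`) are holomorphic on `D` and dominated there by
term values `Σ_{t ∈ terms L M Z} ‖Tt Z t z‖` with `‖Tt Z t z‖ ≤ weight(t)·e^{a₅|Z|}` ([II] (2.14)–(2.26) per term at complexified older terms), THEN module J42's per-torus `h226TOnOlder` body
holds for the run tower `truncRun K (toClusterTower Gn)` at EVERY level `k′`, window history `g ∈ ]0, γ]^ℕ` and older coordinate `i < k′`: module 16′ §1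
`termwise226OnOlder_toClusterTower_of_stepSchemas` (levels `< K`) into module 15′ `termwise226OnOlder_truncRun` (levels `≥ K` termless).  Hypothesis form; nothing of [II] asserted. [folklore] -/
theorem h226TOnOlder_truncRun_toClusterTower_of_genStepSchemas (K : ℕ) {𝔸 : Type*} [NormedRing 𝔸] [NormedAlgebra ℂ 𝔸] [CompleteSpace 𝔸] {G : Type*} [GaugeGroup G]
    {M : ℕ} [NeZero M] (Sg : Setting 𝔸 G) (Rz : Residual (F.P K) 𝔸) (Gn : GenTower (F.P K) 𝔸 M)
    {cs : SFConsts} {γ r A κ : ℝ} (c : B13.Consts) {L : ℕ} [NeZero L] {a a₅ : ℝ} (hA6 : 0 ≤ c.α₆ * c.eps2)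
    (hlocG : ∀ (k' : ℕ), k' < K → ∀ (t : ℂ) (old old' : OlderTerms (F.P K) 𝔸 M k') (φ : CPair (F.P K) 𝔸) (Z : (domSys (F.P K) M (k' + 1)).Dom),
      (∀ (j : Fin (k' + 1)) (Y : (domSys (F.P K) M j).Dom) (ψ : CPair (F.P K) 𝔸), ψ ∈ spaceI Sg Rz M j (domSites (F.P K) M j Y) cs.α₀ cs.α₁ →
        old j Y ψ = old' j Y ψ) → (Gn k').H t old φ Z = (Gn k').H t old' φ Z)
    (h226G : ∀ (k' : ℕ), k' < K → ∀ (D : Set ℂ), IsOpen D → (∀ t ∈ Ioc (0 : ℝ) γ, closedBall (t : ℂ) r ⊆ D) → ∀ (s : ℝ), s ∈ Ioc (0 : ℝ) γ →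
      ∀ (cv : ℂ → OlderTerms (F.P K) 𝔸 M k'),
      (∀ (j : Fin (k' + 1)) (Y : (domSys (F.P K) M j).Dom) (ψ : CPair (F.P K) 𝔸), ψ ∈ spaceI Sg Rz M j (domSites (F.P K) M j Y) cs.α₀ cs.α₁ →
        DifferentiableOn ℂ (fun z => cv z j Y ψ) D ∧ ∀ z ∈ D, ‖cv z j Y ψ‖ ≤ A * Real.exp (-(κ * torusTreeLen Y.1))) →
      ∀ (X : (domSys (F.P K) M (k' + 1)).Dom) (φ : CPair (F.P K) 𝔸), φ ∈ spaceI Sg Rz M (k' + 1) (domSites (F.P K) M (k' + 1) X) cs.α₀ cs.α₁ →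
      ∃ Tt : (Z : TDom 4 (domCount (F.P K) M (k' + 1))) →
          Finset (TDom 4 (L * domCount (F.P K) M (k' + 1))) × Finset (TBond 4 M (L * domCount (F.P K) M (k' + 1))) → ℂ → ℂ,
        (∀ Z : (domSys (F.P K) M (k' + 1)).Dom, Z.1 ⊆ X.1 → DifferentiableOn ℂ (fun z => (Gn k').H (s : ℂ) (cv z) φ Z) D) ∧
        (∀ z ∈ D, ∀ Z : TDom 4 (domCount (F.P K) M (k' + 1)), Z.1 ⊆ X.1 → ‖(Gn k').H (s : ℂ) (cv z) φ Z‖ ≤ ∑ t ∈ terms L M Z, ‖Tt Z t z‖) ∧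
        (∀ z ∈ D, ∀ Z : TDom 4 (domCount (F.P K) M (k' + 1)), Z.1 ⊆ X.1 → ∀ t ∈ terms L M Z,
          ‖Tt Z t z‖ ≤ weight L M c Z a t * Real.exp (a₅ * ((Z.1).card : ℝ)))) :
    ∀ (D : Set ℂ), IsOpen D → (∀ t ∈ Ioc (0 : ℝ) γ, closedBall (t : ℂ) r ⊆ D) →
      ∀ (k' : ℕ) (g : ℕ → ℝ), g ∈ Window γ → ∀ (i : ℕ), i < k' → ∀ (X : (domSys (F.P K) M (k' + 1)).Dom) (φ : CPair (F.P K) 𝔸),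
      φ ∈ spaceI Sg Rz M (k' + 1) (domSites (F.P K) M (k' + 1) X) cs.α₀ cs.α₁ →
      (∀ (j : ℕ), j < k' + 1 → ∀ (Y : (domSys (F.P K) M j).Dom) (ψ : CPair (F.P K) 𝔸), ψ ∈ spaceI Sg Rz M j (domSites (F.P K) M j Y) cs.α₀ cs.α₁ →
        ∃ Ec : ℂ → ℂ, DifferentiableOn ℂ Ec D ∧ (∀ z ∈ D, ‖Ec z‖ ≤ A * Real.exp (-(κ * torusTreeLen Y.1))) ∧
          (∀ t ∈ Ioc (0 : ℝ) γ, Ec t = termC (truncRun K (toClusterTower Gn)) j Y (Function.update g i t) ψ)) →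
      ∃ (Hc : ℂ → TDom 4 (domCount (F.P K) M (k' + 1)) → ℂ)
        (Tt : (Z : TDom 4 (domCount (F.P K) M (k' + 1))) →
          Finset (TDom 4 (L * domCount (F.P K) M (k' + 1))) × Finset (TBond 4 M (L * domCount (F.P K) M (k' + 1))) → ℂ → ℂ),
        (∀ Z : (domSys (F.P K) M (k' + 1)).Dom, Z.1 ⊆ X.1 → DifferentiableOn ℂ (fun z => Hc z Z) D) ∧
        (∀ z ∈ D, ∀ Z : TDom 4 (domCount (F.P K) M (k' + 1)), Z.1 ⊆ X.1 → ‖Hc z Z‖ ≤ ∑ t ∈ terms L M Z, ‖Tt Z t z‖) ∧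
        (∀ z ∈ D, ∀ Z : TDom 4 (domCount (F.P K) M (k' + 1)), Z.1 ⊆ X.1 → ∀ t ∈ terms L M Z,
          ‖Tt Z t z‖ ≤ weight L M c Z a t * Real.exp (a₅ * ((Z.1).card : ℝ))) ∧
        (∀ t ∈ Ioc (0 : ℝ) γ, Hc t = ((truncRun K (toClusterTower Gn)) k').H (restrictPrefix k' (Function.update g i t)) φ) :=
  termwise226OnOlder_truncRun K Sg Rz (toClusterTower Gn) K c hA6 (termwise226OnOlder_toClusterTower_of_stepSchemas K Sg Rz Gn K c hlocG h226G)

/-! ## §2 At the record: K3's `h9` with the GEOMETRIC moduli from node N18's kernel step rate + the GENERATOR schemas at the generated run towers (module J42 re-keyed by §1) -/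

variable (N : ℕ) [NeZero N]

open Classical in
/-- ★★★ **«J42 AT THE GENERATED RUN TOWERS» — K3⁷ v5 ∕ K3⁸ v6 §2b's `h9` WITH THE RECORD's GEOMETRIC MODULI FROM NODE N18's KERNEL STEP RATE + def-T's GENERATOR READ AT COMPLEXIFIED
OLDER TERMS, NO abstract-tower activity hypothesis.**  One-step generator towers `Gn K : GenTower (F.P K) 𝔸 M` per torus (`M = L_F^{m′}`) whose run towers `truncRun K (toClusterTower (Gn K))`
meet W1-20's law through `emb : ReadingMaps F (MatA N) 𝔸` at the space tables of record `U^c_{k+1}(X, cs.α₀, cs.α₁)` of the settings `(Sg K, Rz K)`; per torus and step `k′ < K`: the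
GENERATOR schemas (S-loc) `hlocG` ∕ (S-226) `h226G` with the letters `(θ.γ, r_E, E₀, κ)` (node N10's T-row complexified — an estimate about the generator, not about free activity data),
node N09's `EHoloAt (sfTowerOfRecord …) cs k` per window history and step with uniform letters `(E₀, r_E > 0)`, the socket numerals with `0 ≤ c.α₆·c.ε₂`, `8 ≤ c.L`, S25's clauses at
`A := C₃ε₁`, the renewal row, `θ.γ ≤ cs.γ`, `κ ≤ cs.κ`; term holomorphy through the complexified readings of record at every window history, chart∕space clauses, site weights with
tails, `δ₀ > 0`, `2κ₀(64,8) ≤ κ_w ≤ κ`; `PolLimitsExistOfRecord₁₃ F N θ`; node N18's `KernelStepRateOfRecord₁₃ F N θ κ₅ ℓ.θ₅ C₅` (`C₅ ≥ 0`); the letter rows `δ₁ ≤ κ₅`, `0 < ℓ.ω`,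
`ℓ.θ₅ ≤ ℓ.ω²`, `ℓ.κ ≤ δ₁`, `(4·(2C₅∕(1−ℓ.θ₅) + 2E₁)∕θ.γ + C₂·θ.γ∕2)∕ℓ.ω ≤ ℓ.C₉` ⟹ **`NE9 ((objectsOfRecord₁₃ F N θ ℓ).EA 0) (Window θ.γ) ℓ.κ ℓ.moduli`** — module J42's
`ne9_EA_objectsOfRecord₁₃_of_kernelStepRate_stripSchemas` at `S := fun K => truncRun K (toClusterTower (Gn K))` with its `h226TOnOlder` PRODUCED by §1.  LOCATED (hypothesis form);
N22 NOT discharged. [folklore] -/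
theorem ne9_EA_objectsOfRecord₁₃_of_kernelStepRate_genStepSchemas (θ : Stage13Params F N) (ℓ : U3Letters₁₁) (hs : ℓ.Signs) (hγ0 : 0 < θ.γ)
    (hlim : PolLimitsExistOfRecord₁₃ F N θ) {κ₅ C₅ : ℝ} (hC₅ : 0 ≤ C₅) (h5 : KernelStepRateOfRecord₁₃ F N θ κ₅ ℓ.θ₅ C₅)
    {𝔸 : Type*} [NormedRing 𝔸] [NormedAlgebra ℂ 𝔸] [CompleteSpace 𝔸] {G : Type*} [GaugeGroup G]
    (m' : ℕ) (M : ℕ) [NeZero M] (hM : M = F.L ^ m')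
    (Gn : (K : ℕ) → GenTower (F.P K) 𝔸 M) (emb : ReadingMaps F (MatA N) 𝔸)
    (hloc : Localizes17OfRecord₁₃ F N θ (fun K => truncRun K (toClusterTower (Gn K))) emb)
    (Sg : (K : ℕ) → Setting 𝔸 G) (Rz : (K : ℕ) → Residual (F.P K) 𝔸) (logZ : (K : ℕ) → ℕ → GaugeField (F.P K) 0 G → ℝ) (β : ℕ → ℕ → ℝ → ℝ)
    (c : B13.Consts) {L : ℕ} [NeZero L] (hL : 8 ≤ c.L) (hLc : c.L = L) {a a₂ a₂' a₅ Aabs : ℝ} (hN : Lemma3Numerics c M ((c.L : ℝ) / 2) a a₂ a₂' a₅ Aabs)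
    (cs : SFConsts) (hγ : θ.γ ≤ cs.γ)
    {rE E₀ κ r₁ κw δ₀ B₃ r : ℝ} (hrE : 0 < rE) (hA0 : 0 ≤ c.C3act * c.ε₁) (hr₁ : 0 ≤ r₁) (hκ : κ ≤ r₁)
    (hrate : r₁ + 2 * (64 * Real.log 162) + 2 ≤ (1 - 8 * c.δ) * ((c.L : ℝ) / 2) * c.κ)
    (hsmall : c.C3act * c.ε₁ * Real.exp (5 * r₁ + 1) * K₀ 64 8 * 9 * 64 ≤ 1)
    (hrenew : Real.exp 1 * 9 * 64 * K₀ 64 8 ^ 2 * (c.C3act * c.ε₁) ≤ E₀) (hκc : κ ≤ cs.κ)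
    (hκ₀ : kappa₀ (4 * 2 ^ 4) (2 * 4) ≤ κw / 2) (hκw : κw ≤ κ) (hδ₀ : 0 < δ₀) (hB₃ : 0 ≤ B₃) (hr : 0 < r)
    (hA6 : 0 ≤ c.α₆ * c.eps2)
    (hlocG : ∀ K : ℕ, ∀ (k' : ℕ), k' < K → ∀ (t : ℂ) (old old' : OlderTerms (F.P K) 𝔸 M k') (φ : CPair (F.P K) 𝔸) (Z : (domSys (F.P K) M (k' + 1)).Dom),
      (∀ (j : Fin (k' + 1)) (Y : (domSys (F.P K) M j).Dom) (ψ : CPair (F.P K) 𝔸), ψ ∈ spaceI (Sg K) (Rz K) M j (domSites (F.P K) M j Y) cs.α₀ cs.α₁ →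
        old j Y ψ = old' j Y ψ) → (Gn K k').H t old φ Z = (Gn K k').H t old' φ Z)
    (h226G : ∀ K : ℕ, ∀ (k' : ℕ), k' < K → ∀ (D : Set ℂ), IsOpen D → (∀ t ∈ Ioc (0 : ℝ) θ.γ, closedBall (t : ℂ) rE ⊆ D) → ∀ (s : ℝ), s ∈ Ioc (0 : ℝ) θ.γ →
      ∀ (cv : ℂ → OlderTerms (F.P K) 𝔸 M k'),
      (∀ (j : Fin (k' + 1)) (Y : (domSys (F.P K) M j).Dom) (ψ : CPair (F.P K) 𝔸), ψ ∈ spaceI (Sg K) (Rz K) M j (domSites (F.P K) M j Y) cs.α₀ cs.α₁ →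
        DifferentiableOn ℂ (fun z => cv z j Y ψ) D ∧ ∀ z ∈ D, ‖cv z j Y ψ‖ ≤ E₀ * Real.exp (-(κ * torusTreeLen Y.1))) →
      ∀ (X : (domSys (F.P K) M (k' + 1)).Dom) (φ : CPair (F.P K) 𝔸), φ ∈ spaceI (Sg K) (Rz K) M (k' + 1) (domSites (F.P K) M (k' + 1) X) cs.α₀ cs.α₁ →
      ∃ Tt : (Z : TDom 4 (domCount (F.P K) M (k' + 1))) →
          Finset (TDom 4 (L * domCount (F.P K) M (k' + 1))) × Finset (TBond 4 M (L * domCount (F.P K) M (k' + 1))) → ℂ → ℂ,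
        (∀ Z : (domSys (F.P K) M (k' + 1)).Dom, Z.1 ⊆ X.1 → DifferentiableOn ℂ (fun z => (Gn K k').H (s : ℂ) (cv z) φ Z) D) ∧
        (∀ z ∈ D, ∀ Z : TDom 4 (domCount (F.P K) M (k' + 1)), Z.1 ⊆ X.1 → ‖(Gn K k').H (s : ℂ) (cv z) φ Z‖ ≤ ∑ t ∈ terms L M Z, ‖Tt Z t z‖) ∧
        (∀ z ∈ D, ∀ Z : TDom 4 (domCount (F.P K) M (k' + 1)), Z.1 ⊆ X.1 → ∀ t ∈ terms L M Z,
          ‖Tt Z t z‖ ≤ weight L M c Z a t * Real.exp (a₅ * ((Z.1).card : ℝ))))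
    (hE : ∀ (K : ℕ), ∀ g ∈ Window θ.γ, ∀ k : ℕ, ∃ H : EHoloAt (sfTowerOfRecord (Sg K) (Rz K) M (truncRun K (toClusterTower (Gn K))) ⟨g, β K⟩ (logZ K)) cs k, H.E₀ ≤ E₀ ∧ rE ≤ H.r)
    (Ec : ℕ → ℕ → Type*) [∀ K k, NormedAddCommGroup (Ec K k)] [∀ K k, NormedSpace ℂ (Ec K k)]
    (ι : letI := θ.instVβ₁; letI := θ.instVβ₂
      (K k : ℕ) → (domSys (F.P K) M (k + 1)).Dom → ((Fin (F.P K).d → Site (F.P K) (k + 1) → θ.Vβ) →L[ℝ] Ec K k))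
    (Φ : (K k : ℕ) → (domSys (F.P K) M (k + 1)).Dom → Ec K k → CPair (F.P K) 𝔸)
    (U : (K k : ℕ) → (domSys (F.P K) M (k + 1)).Dom → Set (Ec K k)) (hU : ∀ K k X, IsOpen (U K k X)) (hrU : ∀ K k X, ball (0 : Ec K k) r ⊆ U K k X)
    (hEhol : ∀ g ∈ Window θ.γ, ∀ (K k : ℕ) (X : (domSys (F.P K) M (k + 1)).Dom),
      DifferentiableOn ℂ (fun z => ((truncRun K (toClusterTower (Gn K))) k).E (histPrefix g k) (Φ K k X z) X) (U K k X))
    (hΦemb : letI := θ.instVβ₁; letI := θ.instVβ₂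
      ∀ (K k : ℕ) (X : (domSys (F.P K) M (k + 1)).Dom) (B : Fin (F.P K).d → Site (F.P K) (k + 1) → θ.Vβ),
        Φ K k X (ι K k X B) = emb K k (fun l t => NormedSpace.exp (θ.ρ8 (B l t))))
    (hΦsp : ∀ (K k : ℕ) (X : (domSys (F.P K) M (k + 1)).Dom), ∀ z ∈ ball (0 : Ec K k) r,
      Φ K k X z ∈ spaceI (Sg K) (Rz K) M (k + 1) (domSites (F.P K) M (k + 1) X) cs.α₀ cs.α₁)
    (w : (K k : ℕ) → (domSys (F.P K) M (k + 1)).Dom → Site (F.P K) (k + 1) → ℝ) (hw₀ : ∀ K k X t, 0 ≤ w K k X t)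
    (hw : letI := θ.instVβ₁; letI := θ.instVβ₂; letI := θ.instιβ
      ∀ (K k : ℕ) (X : (domSys (F.P K) M (k + 1)).Dom) (l : Fin (F.P K).d) (t : Site (F.P K) (k + 1)) (cc : θ.ιβ),
        ‖ι K k X (Pi.single l (Pi.single t (θ.bV cc)))‖ ≤ w K k X t)
    (htail : ∀ (K k : ℕ) (X : (domSys (F.P K) M (k + 1)).Dom) (t : Site (F.P K) (k + 1)),
      let e : Site (F.P K) (k + 1) → TPt 4 (domCount (F.P K) M (k + 1) * M) := fun x i => (ZMod.cast (x i) : ZMod (domCount (F.P K) M (k + 1) * M))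
      w K k X t ≤ B₃ * Real.exp (-δ₀ * distCT (domCount (F.P K) M (k + 1)) M (e t) (nearT (M := M) (e t) X)))
    (hκ₅ : delta1 δ₀ κw ((M : ℝ) * 4) ≤ κ₅) (hω : 0 < ℓ.ω) (hθω : ℓ.θ₅ ≤ ℓ.ω ^ 2) (hℓκ : ℓ.κ ≤ delta1 δ₀ κw ((M : ℝ) * 4))
    (hC₉ : (4 * (2 * C₅ / (1 - ℓ.θ₅) +
        2 * ((16 * E₀ * B₃ ^ 2 / r ^ 2) * Real.exp (delta1 δ₀ κw ((M : ℝ) * 4) * ((M : ℝ) * 4) * 3) * K₀ (4 * 2 ^ 4) (2 * 4) * K₁ 4 (δ₀ / 2))) / θ.γ +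
        ((16 * (64 * E₀ / rE ^ 2) * B₃ ^ 2 / r ^ 2) * Real.exp (delta1 δ₀ κw ((M : ℝ) * 4) * ((M : ℝ) * 4) * 3) * K₀ (4 * 2 ^ 4) (2 * 4) *
          K₁ 4 (δ₀ / 2)) * θ.γ / 2) / ℓ.ω ≤ ℓ.C₉) :
    NE9 ((objectsOfRecord₁₃ F N θ ℓ).EA 0) (Window θ.γ) ℓ.κ ℓ.moduli :=
  ne9_EA_objectsOfRecord₁₃_of_kernelStepRate_stripSchemas F N θ ℓ hs hγ0 hlim hC₅ h5 m' M hM (fun K => truncRun K (toClusterTower (Gn K))) emb hloc Sg Rz logZ β c hL hLc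
    hN cs hγ hrE hA0 hr₁ hκ hrate hsmall hrenew hκc hκ₀ hκw hδ₀ hB₃ hr
    (fun K => h226TOnOlder_truncRun_toClusterTower_of_genStepSchemas F K (Sg K) (Rz K) (Gn K) c hA6 (hlocG K) (h226G K))
    hE Ec ι Φ U hU hrU hEhol hΦemb hΦsp w hw₀ hw htail hκ₅ hω hθω hℓκ hC₉

/-! ## §3 The N22 pin face at the generated run towers -/

open Classical in
/-- ★★★ **THE N22 PIN FACE FROM NODE N18's KERNEL STEP RATE + THE GENERATOR SCHEMAS AT THE GENERATED RUN TOWERS** — `N22At (rateCarriersOfRecord₁₃CoPH 𝔯 F θ hP g₀ os k).u3` for EVERY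
`k` under the node-U3 pin `hpin` at the tuple (dag-n22-w3's `n22At_rateCarriers_of_kernels_pin_of_ne9` on §2 at `θ.toStage13Params`).  THE N22 ROW SENTENCE, generator currency:
«W1-20's law at the GENERATED run towers + def-T's generator read at complexified older terms ((S-loc), (S-226)) + N09's `EHoloAt` families + N18's kernel step rate + term holomorphy
through the readings + p. 282 tails + (1.21) + numerals + letter rows ⇒ §2b `h9` ∕ `N22At` WITH THE RECORD's GEOMETRIC MODULI». [folklore] -/
theorem n22At_rateCarriers_of_kernels_pin_of_kernelStepRate_genStepSchemas (𝔯 : RateReading₁₃CoPH N) (θ : Stage13HParams F N) (hP : θ.Provisos₁₃CoPH F N)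
    (g₀ : ℕ → ℝ) (os : List (ULoop F)) (ℓ : U3Letters₁₁) (hs : ℓ.Signs) (hγ0 : 0 < θ.γ)
    (hpin : (𝔯.lit F θ hP g₀ os).u3 = objectsOfRecord₁₃ F N θ.toStage13Params ℓ)
    (hlim : PolLimitsExistOfRecord₁₃ F N θ.toStage13Params) {κ₅ C₅ : ℝ} (hC₅ : 0 ≤ C₅) (h5 : KernelStepRateOfRecord₁₃ F N θ.toStage13Params κ₅ ℓ.θ₅ C₅)
    {𝔸 : Type*} [NormedRing 𝔸] [NormedAlgebra ℂ 𝔸] [CompleteSpace 𝔸] {G : Type*} [GaugeGroup G]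
    (m' : ℕ) (M : ℕ) [NeZero M] (hM : M = F.L ^ m')
    (Gn : (K : ℕ) → GenTower (F.P K) 𝔸 M) (emb : ReadingMaps F (MatA N) 𝔸)
    (hloc : Localizes17OfRecord₁₃ F N θ.toStage13Params (fun K => truncRun K (toClusterTower (Gn K))) emb)
    (Sg : (K : ℕ) → Setting 𝔸 G) (Rz : (K : ℕ) → Residual (F.P K) 𝔸) (logZ : (K : ℕ) → ℕ → GaugeField (F.P K) 0 G → ℝ) (β : ℕ → ℕ → ℝ → ℝ)
    (c : B13.Consts) {L : ℕ} [NeZero L] (hL : 8 ≤ c.L) (hLc : c.L = L) {a a₂ a₂' a₅ Aabs : ℝ} (hN : Lemma3Numerics c M ((c.L : ℝ) / 2) a a₂ a₂' a₅ Aabs)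
    (cs : SFConsts) (hγ : θ.γ ≤ cs.γ)
    {rE E₀ κ r₁ κw δ₀ B₃ r : ℝ} (hrE : 0 < rE) (hA0 : 0 ≤ c.C3act * c.ε₁) (hr₁ : 0 ≤ r₁) (hκ : κ ≤ r₁)
    (hrate : r₁ + 2 * (64 * Real.log 162) + 2 ≤ (1 - 8 * c.δ) * ((c.L : ℝ) / 2) * c.κ)
    (hsmall : c.C3act * c.ε₁ * Real.exp (5 * r₁ + 1) * K₀ 64 8 * 9 * 64 ≤ 1)
    (hrenew : Real.exp 1 * 9 * 64 * K₀ 64 8 ^ 2 * (c.C3act * c.ε₁) ≤ E₀) (hκc : κ ≤ cs.κ)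
    (hκ₀ : kappa₀ (4 * 2 ^ 4) (2 * 4) ≤ κw / 2) (hκw : κw ≤ κ) (hδ₀ : 0 < δ₀) (hB₃ : 0 ≤ B₃) (hr : 0 < r)
    (hA6 : 0 ≤ c.α₆ * c.eps2)
    (hlocG : ∀ K : ℕ, ∀ (k' : ℕ), k' < K → ∀ (t : ℂ) (old old' : OlderTerms (F.P K) 𝔸 M k') (φ : CPair (F.P K) 𝔸) (Z : (domSys (F.P K) M (k' + 1)).Dom),
      (∀ (j : Fin (k' + 1)) (Y : (domSys (F.P K) M j).Dom) (ψ : CPair (F.P K) 𝔸), ψ ∈ spaceI (Sg K) (Rz K) M j (domSites (F.P K) M j Y) cs.α₀ cs.α₁ →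
        old j Y ψ = old' j Y ψ) → (Gn K k').H t old φ Z = (Gn K k').H t old' φ Z)
    (h226G : ∀ K : ℕ, ∀ (k' : ℕ), k' < K → ∀ (D : Set ℂ), IsOpen D → (∀ t ∈ Ioc (0 : ℝ) θ.γ, closedBall (t : ℂ) rE ⊆ D) → ∀ (s : ℝ), s ∈ Ioc (0 : ℝ) θ.γ →
      ∀ (cv : ℂ → OlderTerms (F.P K) 𝔸 M k'),
      (∀ (j : Fin (k' + 1)) (Y : (domSys (F.P K) M j).Dom) (ψ : CPair (F.P K) 𝔸), ψ ∈ spaceI (Sg K) (Rz K) M j (domSites (F.P K) M j Y) cs.α₀ cs.α₁ →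
        DifferentiableOn ℂ (fun z => cv z j Y ψ) D ∧ ∀ z ∈ D, ‖cv z j Y ψ‖ ≤ E₀ * Real.exp (-(κ * torusTreeLen Y.1))) →
      ∀ (X : (domSys (F.P K) M (k' + 1)).Dom) (φ : CPair (F.P K) 𝔸), φ ∈ spaceI (Sg K) (Rz K) M (k' + 1) (domSites (F.P K) M (k' + 1) X) cs.α₀ cs.α₁ →
      ∃ Tt : (Z : TDom 4 (domCount (F.P K) M (k' + 1))) →
          Finset (TDom 4 (L * domCount (F.P K) M (k' + 1))) × Finset (TBond 4 M (L * domCount (F.P K) M (k' + 1))) → ℂ → ℂ,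
        (∀ Z : (domSys (F.P K) M (k' + 1)).Dom, Z.1 ⊆ X.1 → DifferentiableOn ℂ (fun z => (Gn K k').H (s : ℂ) (cv z) φ Z) D) ∧
        (∀ z ∈ D, ∀ Z : TDom 4 (domCount (F.P K) M (k' + 1)), Z.1 ⊆ X.1 → ‖(Gn K k').H (s : ℂ) (cv z) φ Z‖ ≤ ∑ t ∈ terms L M Z, ‖Tt Z t z‖) ∧
        (∀ z ∈ D, ∀ Z : TDom 4 (domCount (F.P K) M (k' + 1)), Z.1 ⊆ X.1 → ∀ t ∈ terms L M Z,
          ‖Tt Z t z‖ ≤ weight L M c Z a t * Real.exp (a₅ * ((Z.1).card : ℝ))))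
    (hE : ∀ (K : ℕ), ∀ g ∈ Window θ.γ, ∀ k : ℕ, ∃ H : EHoloAt (sfTowerOfRecord (Sg K) (Rz K) M (truncRun K (toClusterTower (Gn K))) ⟨g, β K⟩ (logZ K)) cs k, H.E₀ ≤ E₀ ∧ rE ≤ H.r)
    (Ec : ℕ → ℕ → Type*) [∀ K k, NormedAddCommGroup (Ec K k)] [∀ K k, NormedSpace ℂ (Ec K k)]
    (ι : letI := θ.instVβ₁; letI := θ.instVβ₂
      (K k : ℕ) → (domSys (F.P K) M (k + 1)).Dom → ((Fin (F.P K).d → Site (F.P K) (k + 1) → θ.Vβ) →L[ℝ] Ec K k))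
    (Φ : (K k : ℕ) → (domSys (F.P K) M (k + 1)).Dom → Ec K k → CPair (F.P K) 𝔸)
    (U : (K k : ℕ) → (domSys (F.P K) M (k + 1)).Dom → Set (Ec K k)) (hU : ∀ K k X, IsOpen (U K k X)) (hrU : ∀ K k X, ball (0 : Ec K k) r ⊆ U K k X)
    (hEhol : ∀ g ∈ Window θ.γ, ∀ (K k : ℕ) (X : (domSys (F.P K) M (k + 1)).Dom),
      DifferentiableOn ℂ (fun z => ((truncRun K (toClusterTower (Gn K))) k).E (histPrefix g k) (Φ K k X z) X) (U K k X))
    (hΦemb : letI := θ.instVβ₁; letI := θ.instVβ₂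
      ∀ (K k : ℕ) (X : (domSys (F.P K) M (k + 1)).Dom) (B : Fin (F.P K).d → Site (F.P K) (k + 1) → θ.Vβ),
        Φ K k X (ι K k X B) = emb K k (fun l t => NormedSpace.exp (θ.ρ8 (B l t))))
    (hΦsp : ∀ (K k : ℕ) (X : (domSys (F.P K) M (k + 1)).Dom), ∀ z ∈ ball (0 : Ec K k) r,
      Φ K k X z ∈ spaceI (Sg K) (Rz K) M (k + 1) (domSites (F.P K) M (k + 1) X) cs.α₀ cs.α₁)
    (w : (K k : ℕ) → (domSys (F.P K) M (k + 1)).Dom → Site (F.P K) (k + 1) → ℝ) (hw₀ : ∀ K k X t, 0 ≤ w K k X t)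
    (hw : letI := θ.instVβ₁; letI := θ.instVβ₂; letI := θ.instιβ
      ∀ (K k : ℕ) (X : (domSys (F.P K) M (k + 1)).Dom) (l : Fin (F.P K).d) (t : Site (F.P K) (k + 1)) (cc : θ.ιβ),
        ‖ι K k X (Pi.single l (Pi.single t (θ.bV cc)))‖ ≤ w K k X t)
    (htail : ∀ (K k : ℕ) (X : (domSys (F.P K) M (k + 1)).Dom) (t : Site (F.P K) (k + 1)),
      let e : Site (F.P K) (k + 1) → TPt 4 (domCount (F.P K) M (k + 1) * M) := fun x i => (ZMod.cast (x i) : ZMod (domCount (F.P K) M (k + 1) * M))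
      w K k X t ≤ B₃ * Real.exp (-δ₀ * distCT (domCount (F.P K) M (k + 1)) M (e t) (nearT (M := M) (e t) X)))
    (hκ₅ : delta1 δ₀ κw ((M : ℝ) * 4) ≤ κ₅) (hω : 0 < ℓ.ω) (hθω : ℓ.θ₅ ≤ ℓ.ω ^ 2) (hℓκ : ℓ.κ ≤ delta1 δ₀ κw ((M : ℝ) * 4))
    (hC₉ : (4 * (2 * C₅ / (1 - ℓ.θ₅) +
        2 * ((16 * E₀ * B₃ ^ 2 / r ^ 2) * Real.exp (delta1 δ₀ κw ((M : ℝ) * 4) * ((M : ℝ) * 4) * 3) * K₀ (4 * 2 ^ 4) (2 * 4) * K₁ 4 (δ₀ / 2))) / θ.γ +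
        ((16 * (64 * E₀ / rE ^ 2) * B₃ ^ 2 / r ^ 2) * Real.exp (delta1 δ₀ κw ((M : ℝ) * 4) * ((M : ℝ) * 4) * 3) * K₀ (4 * 2 ^ 4) (2 * 4) *
          K₁ 4 (δ₀ / 2)) * θ.γ / 2) / ℓ.ω ≤ ℓ.C₉) (k : ℕ) :
    N22At (rateCarriersOfRecord₁₃CoPH 𝔯 F θ hP g₀ os k).u3 :=
  n22At_rateCarriers_of_kernels_pin_of_ne9 𝔯 θ hP g₀ os ℓ hs hpin
    (ne9_EA_objectsOfRecord₁₃_of_kernelStepRate_genStepSchemas F N θ.toStage13Params ℓ hs hγ0 hlim hC₅ h5 m' M hM Gn emb hloc Sg Rz logZ β c hL hLc hN cs hγ hrE hA0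
      hr₁ hκ hrate hsmall hrenew hκc hκ₀ hκw hδ₀ hB₃ hr hA6 hlocG h226G hE Ec ι Φ U hU hrU hEhol hΦemb hΦsp w hw₀ hw htail hκ₅ hω hθω hℓκ hC₉) k

end YMDAG.N22.KernelFading

end
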